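import Summits.Langlands.Langlands.Theorems.PicardMuOrdinaryMuOrdinaryFamilyRTPointAbsIrr
import Summits.Langlands.Langlands.Theorems.PicardMuOrdinaryMuOrdinaryFamilyRTPointDescentPrelim
import Summits.Langlands.Langlands.Theorems.PicardMuOrdinaryMuOrdinaryFamilyRTPoint
import Literature.NumberTheory.GaloisRepresentations.FrobeniusDensity
import Literature.NumberTheory.Automorphic.ChebotarevArtinRepHolds
import Literature.NumberTheory.Automorphic.ReciprocityGLnQlModelProofs
import Literature.NumberTheory.Automorphic.HilbertPartialHasseWeightShiftingProofs

/-!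
# The Picard point of line `free-seed-smooth-rt` (crux `MuOrdinaryFamilyRT`, stmt-Langlands-13757):
# the integral model of `ρ_C` over `𝒪_{E₁}` and its reduction (first half of LEAF `modelCore`)

Helper file for the registered stub `stub_point` (plan: `…PointPlan.lean`).  For generic `f`, a continuous
`ρ : Γ_K → GL₃(ℚ̄₃)` with the Picard Frobenius traces `ι⁻¹ e(a_𝔭(f))` off `S(f)` (clause 1 of
`PicardBorelAt3`), granted `F3 = exists_conj_eq_of_trace_eq_of_isAbsIrreducible_residual`, we PROVE:

* `trace_mem_E₀` — **every trace of `ρ` lies in `E₀ = ℚ₃(ζ₃)`**: the Frobenius traces do (`mem_E₀_of_K`),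
  they are dense (Chebotarev, `absoluteGaloisGroup.frobenius_dense` + `chebotarev_artinRep_holds`), the
  trace is continuous and `E₀` is closed;
* `norm_picardC_sub_lt_one` — `ι⁻¹ e(a_𝔭) = (N_𝔭 - 1) + w`, `‖w‖ < 1`, `N_𝔭 = #roots(f mod 𝔭)`
  (`picardTrace_sub_card_roots_sub_one_mem_span`, `‖1 - ζ₃‖ < 1`);
* **`exists_integralModel_E₁`** — a finite `E₁ ⊇ E₀` (`exists_hasQlModel_holds`, `E₁ = E ⊔ E₀`), a
  stable lattice (`exists_integralModel`) giving `ρ_A : Γ_K → GL₃(𝒪_{E₁})` conjugate to `ρ` over `ℚ̄₃`,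
  `𝔪`-adically continuous (`isAdicContinuous_of_integralModel`), with all traces in `E₀`, residual traces
  EQUAL to the heart traces (a clopen condition — open kernels — checked on the dense Frobenius elements
  through `rbarTraceFrob` and `norm_picardC_sub_lt_one`), hence, by `F3` over the residue field against
  `r̄_f^B ⊗ k` (absolutely irreducible: `rbarAbsIrreducible`), absolutely irreducible reduction.
-/

-- `Summit.Langlands.Langlands.…` (summit = sub-problem name, D-0017 layout) trips `dupNamespace` on every decl.
set_option linter.dupNamespace false

namespace Summit.Langlands.Langlands.Cruxes.MuOrdinaryFamilyRT.FreeSeedSmoothRt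

open scoped NumberField Polynomial Matrix Classical
open Field IsDedekindDomain IsLocalRing Metric
open Literature.NumberTheory.GaloisRepresentations Literature.NumberTheory.Automorphic

noncomputable section

/-! ### All traces of `ρ_C` lie in `E₀` -/

section Traces

variable {ι : PadicAlgCl 3 ≃+* ℂ} {e : K →+* ℂ} {f : ℤ[X]} (hgen : Generic f)
  (ρ : FramedGaloisRep K (PadicAlgCl 3) 3)
  (h1 : ∀ 𝔭 ∉ badPrimes f, ρ.IsUnramifiedAt 𝔭 ∧
    ∀ 𝔓 ∈ 𝔭.primesAbove, ∀ σ : absoluteGaloisGroup K, IsArithFrobAt (𝓞 K) σ 𝔓 → ρ.trace σ = picardC f ι e 𝔭)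
include hgen h1

omit hgen h1 in
/-- `E₀ ⊆ ℚ̄₃` is closed (a finite-dimensional `ℚ₃`-subspace). -/
theorem isClosed_E₀ : IsClosed ((E₀ ι e : Set (PadicAlgCl 3))) := by
  haveI : FiniteDimensional ℚ_[3] (Subalgebra.toSubmodule (E₀ ι e).toSubalgebra) :=
    inferInstanceAs (FiniteDimensional ℚ_[3] (E₀ ι e))
  exact (E₀ ι e).toSubalgebra.toSubmodule.closed_of_finiteDimensional

/-- **Every trace of `ρ` lies in `E₀`**: the Frobenius traces `ι⁻¹ e(a_𝔭(f))` do (`mem_E₀_of_K`), they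
are dense (Chebotarev, `absoluteGaloisGroup.frobenius_dense`), the trace is continuous and `E₀` is closed. -/
theorem trace_mem_E₀ (g : absoluteGaloisGroup K) : ρ.trace g ∈ E₀ ι e := by
  have hdense := absoluteGaloisGroup.frobenius_dense chebotarev_artinRep_holds K (badPrimes f) (badPrimes_finite hgen)
  have hclosed : IsClosed {σ : absoluteGaloisGroup K | ρ.trace σ ∈ (E₀ ι e : Set (PadicAlgCl 3))} :=
    isClosed_E₀.preimage (FramedRep.continuous_trace ρ)
  have hsub : {σ : absoluteGaloisGroup K | ∃ v ∉ badPrimes f, ∃ 𝔓 ∈ v.primesAbove, IsArithFrobAt (𝓞 K) σ 𝔓} ⊆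
      {σ : absoluteGaloisGroup K | ρ.trace σ ∈ (E₀ ι e : Set (PadicAlgCl 3))} := by
    rintro σ ⟨v, hv, 𝔓, h𝔓, hσ⟩
    rw [Set.mem_setOf_eq, (h1 v hv).2 𝔓 h𝔓 σ hσ]
    exact mem_E₀_of_K ι e _
  have := (hdense.mono hsub).closure_eq
  rw [hclosed.closure_eq] at this
  have hg : g ∈ (Set.univ : Set (absoluteGaloisGroup K)) := Set.mem_univ g
  rw [← this] at hg
  exact hg

omit h1 in
/-- **The Frobenius traces reduce to the heart traces**: for `𝔭 ∉ S(f)` and an arithmetic Frobenius `σ`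
at `𝔓 ∣ 𝔭`, `ι⁻¹ e(a_𝔭(f)) = (N - 1) + w` with `N = #roots(f mod 𝔭)`, `‖w‖ < 1`
(`a_𝔭 ≡ N - 1 (mod 1 - ζ₃)`, `picardTrace_sub_card_roots_sub_one_mem_span`, and `‖1 - ζ₃‖ < 1`). -/
theorem norm_picardC_sub_lt_one {𝔭 : HeightOneSpectrum (𝓞 K)} (h𝔭 : 𝔭 ∉ badPrimes f) :
    ‖picardC f ι e 𝔭 - ((((fbar f 𝔭).roots.toFinset.card : ℕ) : PadicAlgCl 3) - 1)‖ < 1 := by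
  have hζK : IsPrimitiveRoot (isPrimitiveRoot_zetaK.toInteger : 𝓞 K) 3 :=
    IsPrimitiveRoot.of_map_of_injective (f := algebraMap (𝓞 K) K) (by exact isPrimitiveRoot_zetaK)
      (FaithfulSMul.algebraMap_injective _ _)
  have h3 := three_not_mem_of_not_mem_badPrimes h𝔭
  have hf0 : fbar f 𝔭 ≠ 0 := fbar_ne_zero hgen h𝔭
  obtain ⟨y, hy⟩ := Ideal.mem_span_singleton'.mp (picardTrace_sub_card_roots_sub_one_mem_span hζK f h3 hf0)
  set gK : 𝓞 K →+* PadicAlgCl 3 := ι.symm.toRingHom.comp (e.comp (algebraMap (𝓞 K) K)) with hgK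
  have hpc : picardC f ι e 𝔭 = gK (picardTrace f 𝔭) := rfl
  have hζ3 : gK isPrimitiveRoot_zetaK.toInteger = zeta3 ι e := rfl
  have key : picardC f ι e 𝔭 - ((((fbar f 𝔭).roots.toFinset.card : ℕ) : PadicAlgCl 3) - 1) = gK y * -piE ι e := by
    have := congrArg gK hy
    rw [map_mul, map_sub, hζ3, map_one, map_sub, map_sub, map_natCast, map_one] at this
    rw [hpc, ← this, piE, neg_sub]
  rw [key, norm_mul, norm_neg]
  have hy1 : ‖gK y‖ ≤ 1 :=
    PadicAlgCl.norm_le_one_of_isIntegral 3 (map_isIntegral_int (ι.symm.toRingHom.comp e) (NumberField.RingOfIntegers.isIntegral_coe y))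
  exact mul_lt_one_of_nonneg_of_lt_one_right hy1 (norm_nonneg _) (norm_piE_lt_one ι e)

end Traces

/-! ### The integral model over `𝒪_{E₁}`, `E₁ = E · E₀` finite over `ℚ₃` -/

section IntegralModel

/-- The inclusion `𝒪_L → ℚ̄₃`. -/
def jInt (L : IntermediateField ℚ_[3] (PadicAlgCl 3)) : intermediateFieldIntegers 3 L →+* PadicAlgCl 3 :=
  (algebraMap L (PadicAlgCl 3)).comp (intermediateFieldIntegers 3 L).subtype

/-- `jInt L a = a` in `ℚ̄₃`. -/
@[simp] theorem jInt_apply (L : IntermediateField ℚ_[3] (PadicAlgCl 3)) (a : intermediateFieldIntegers 3 L) :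
    jInt L a = ((a : L) : PadicAlgCl 3) := rfl

/-- The trace of `GL_n(φ)(g)` is `φ(tr g)`. -/
theorem trace_generalLinearGroup_map {A C : Type*} [CommRing A] [CommRing C] {n : Type*} [Fintype n] [DecidableEq n]
    (φ : A →+* C) (g : GL n A) : (Matrix.GeneralLinearGroup.map φ g).val.trace = φ g.val.trace := by
  change (g.val.map φ).trace = _
  rw [← AddMonoidHom.map_trace]

variable {ι : PadicAlgCl 3 ≃+* ℂ} {e : K →+* ℂ} {f : ℤ[X]} (hgen : Generic f)
  (B : Module.Basis (Fin 3) (ZMod 3) (Heart 3 (Roots f)))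
  (hirr : IsAbsIrreducible (rbar f B))
  (hF3 : exists_conj_eq_of_trace_eq_of_isAbsIrreducible_residual)
  (ρ : FramedGaloisRep K (PadicAlgCl 3) 3)
  (h1 : ∀ 𝔭 ∉ badPrimes f, ρ.IsUnramifiedAt 𝔭 ∧
    ∀ 𝔓 ∈ 𝔭.primesAbove, ∀ σ : absoluteGaloisGroup K, IsArithFrobAt (𝓞 K) σ 𝔓 → ρ.trace σ = picardC f ι e 𝔭)
include hgen hirr hF3 h1

/-- **The integral model.**  There are a finite `E₁ ⊇ E₀` and `ρ_A : Γ_K → GL₃(𝒪_{E₁})`, conjugate to `ρ`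
over `ℚ̄₃`, `𝔪`-adically continuous, with residually open kernel, all traces in `E₀`, residual traces
equal to the heart traces, and absolutely irreducible reduction. -/
theorem exists_integralModel_E₁ :
    ∃ (E₁ : IntermediateField ℚ_[3] (PadicAlgCl 3)) (_ : FiniteDimensional ℚ_[3] E₁) (_ : E₀ ι e ≤ E₁)
      (ρA : absoluteGaloisGroup K →* GL (Fin 3) (intermediateFieldIntegers 3 E₁)) (P : GL (Fin 3) (PadicAlgCl 3)),
      (∀ g, (ρ g : GL (Fin 3) (PadicAlgCl 3)) = P * Matrix.GeneralLinearGroup.map (jInt E₁) (ρA g) * P⁻¹) ∧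
      Deformation.IsAdicContinuous ρA ∧
      (∀ g, jInt E₁ (ρA g).val.trace ∈ E₀ ι e) ∧
      (∀ g, residue (intermediateFieldIntegers 3 E₁) (ρA g).val.trace = ((rbar f B g).val.trace : ZMod 3).cast) ∧
      IsAbsIrreducible ((Matrix.GeneralLinearGroup.map (residue (intermediateFieldIntegers 3 E₁))).comp ρA) := by
  -- (1) a model over a finite `E`, enlarged to `E₁ = E ⊔ E₀`
  obtain ⟨E, rE, hfin, P₁, hP₁⟩ := exists_hasQlModel_holds ρ
  haveI := hfin
  set E₁ : IntermediateField ℚ_[3] (PadicAlgCl 3) := E ⊔ E₀ ι e with hE₁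
  haveI hfin₁ : FiniteDimensional ℚ_[3] E₁ := IntermediateField.finiteDimensional_sup E (E₀ ι e)
  have hleE : E ≤ E₁ := le_sup_left
  have hle₀ : E₀ ι e ≤ E₁ := le_sup_right
  set incl : E →+* E₁ := (IntermediateField.inclusion hleE).toRingHom with hincl
  have hincl_cont : Continuous incl := continuous_induced_rng.2 continuous_subtype_val
  set r₁ : FramedGaloisRep K E₁ 3 := rE.baseChange incl hincl_cont with hr₁
  -- (2) a stable lattice
  set O := intermediateFieldIntegers 3 E₁ with hO
  obtain ⟨P₂, ρA, hρA⟩ := exists_integralModel (O := O) (isOpen_integers E₁) r₁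
  -- (3) conjugacy over `ℚ̄₃`
  set P₂' : GL (Fin 3) (PadicAlgCl 3) := Matrix.GeneralLinearGroup.map (algebraMap E₁ (PadicAlgCl 3)) P₂ with hP₂'
  have hconj : ∀ g, (ρ g : GL (Fin 3) (PadicAlgCl 3)) =
      (P₁ * P₂') * Matrix.GeneralLinearGroup.map (jInt E₁) (ρA g) * (P₁ * P₂')⁻¹ := by
    intro g
    have hρg : (ρ g : GL (Fin 3) (PadicAlgCl 3)) =
        P₁ * Matrix.GeneralLinearGroup.map (algebraMap E (PadicAlgCl 3)) (rE g) * P₁⁻¹ := by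
      rw [← hP₁]; rfl
    have hbc : Matrix.GeneralLinearGroup.map (algebraMap E (PadicAlgCl 3)) (rE g) =
        Matrix.GeneralLinearGroup.map (algebraMap E₁ (PadicAlgCl 3)) (r₁ g) :=
      Units.ext (Matrix.ext fun _ _ => rfl)
    have hr₁g : (r₁ g : GL (Fin 3) E₁) = P₂ * Matrix.GeneralLinearGroup.map O.subtype (ρA g) * P₂⁻¹ := by
      rw [hρA g]; group
    have hmap : Matrix.GeneralLinearGroup.map (algebraMap E₁ (PadicAlgCl 3)) (Matrix.GeneralLinearGroup.map O.subtype (ρA g)) =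
        Matrix.GeneralLinearGroup.map (jInt E₁) (ρA g) := Units.ext (Matrix.ext fun _ _ => rfl)
    rw [hρg, hbc, hr₁g, map_mul, map_mul, map_inv, hmap, hP₂', mul_inv_rev]
    simp only [mul_assoc]
  -- (4) traces
  have htr : ∀ g, jInt E₁ (ρA g).val.trace = ρ.trace g := fun g => by
    rw [FramedRep.trace, hconj g, trace_conj_map]
  have htr₀ : ∀ g, jInt E₁ (ρA g).val.trace ∈ E₀ ι e := fun g => by
    rw [htr]; exact trace_mem_E₀ hgen ρ h1 g
  -- (5) continuity
  have hcont : Deformation.IsAdicContinuous ρA := isAdicContinuous_of_integralModel E₁ hρA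
  have hker : IsOpen ((((Matrix.GeneralLinearGroup.map (residue O)).comp ρA).ker : Subgroup (absoluteGaloisGroup K)) :
      Set (absoluteGaloisGroup K)) :=
    isOpen_ker_residualRep (isOpen_maximalIdeal_set E₁) hρA
  -- (6) residual traces: a clopen condition, checked on the dense Frobenius elements
  haveI := charP_residueField E₁
  letI := algebraZModResidueField E₁
  have hcast : ∀ x : ZMod 3, (x.cast : ResidueField O) = algebraMap (ZMod 3) (ResidueField O) x := fun x => by
    change _ = ZMod.castHom (dvd_refl 3) (ResidueField O) x
    rw [ZMod.castHom_apply]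
  have hres : ∀ g, residue O (ρA g).val.trace = ((rbar f B g).val.trace : ZMod 3).cast := by
    set Z : Set (absoluteGaloisGroup K) := {g | residue O (ρA g).val.trace = ((rbar f B g).val.trace : ZMod 3).cast} with hZ
    -- `Z` is the preimage of a set under a homomorphism with open kernel, hence clopen
    set π : absoluteGaloisGroup K →* GL (Fin 3) (ResidueField O) × GL (Fin 3) (ZMod 3) :=
      ((Matrix.GeneralLinearGroup.map (residue O)).comp ρA).prod (rbar f B) with hπ
    have hπker : IsOpen ((π.ker : Subgroup (absoluteGaloisGroup K)) : Set (absoluteGaloisGroup K)) := by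
      rw [hπ, MonoidHom.ker_prod, Subgroup.coe_inf]
      exact hker.inter (isOpen_ker_rbar f B)
    have hZπ : Z = π ⁻¹' {p | p.1.val.trace = (p.2.val.trace : ZMod 3).cast} := by
      ext g
      simp only [hZ, hπ, Set.mem_setOf_eq, Set.mem_preimage, MonoidHom.prod_apply, MonoidHom.comp_apply,
        trace_generalLinearGroup_map]
    have hZclosed : IsClosed Z := by
      rw [← isOpen_compl_iff, hZπ, ← Set.preimage_compl]
      exact isOpen_preimage_of_isOpen_ker π hπker _
    -- the Frobenius elements lie in `Z`
    have hdense := absoluteGaloisGroup.frobenius_dense chebotarev_artinRep_holds K (badPrimes f) (badPrimes_finite hgen)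
    have hsub : {σ : absoluteGaloisGroup K | ∃ v ∉ badPrimes f, ∃ 𝔓 ∈ v.primesAbove, IsArithFrobAt (𝓞 K) σ 𝔓} ⊆ Z := by
      rintro σ ⟨v, hv, 𝔓, h𝔓, hσ⟩
      rw [hZ, Set.mem_setOf_eq, rbarTraceFrob f B hgen v hv 𝔓 h𝔓 σ hσ]
      set N : ℕ := (fbar f v).roots.toFinset.card with hN
      have hlt := norm_picardC_sub_lt_one (ι := ι) (e := e) hgen hv
      rw [← (h1 v hv).2 𝔓 h𝔓 σ hσ, ← htr σ, ← hN] at hlt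
      -- so `tr ρA σ - (N - 1) ∈ 𝔪`
      have hmem : (ρA σ).val.trace - ((N : O) - 1) ∈ maximalIdeal O := by
        rw [intermediateFieldIntegers.mem_maximalIdeal_iff, intermediateFieldIntegers.norm_coe]
        convert hlt using 2
        simp [jInt_apply]
      have h2 := (residue_eq_zero_iff ((ρA σ).val.trace - ((N : O) - 1))).mpr hmem
      rw [map_sub, sub_eq_zero, map_sub, map_natCast, map_one] at h2
      rw [h2, hcast, map_sub, map_natCast, map_one]
    intro g
    have := (hdense.mono hsub).closure_eq
    rw [hZclosed.closure_eq] at this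
    have hg : g ∈ (Set.univ : Set (absoluteGaloisGroup K)) := Set.mem_univ g
    rw [← this] at hg
    exact hg
  -- (7) absolute irreducibility of the reduction, by `F3` over the residue field against the heart
  have habs : IsAbsIrreducible ((Matrix.GeneralLinearGroup.map (residue O)).comp ρA) := by
    haveI : IsAdicComplete (maximalIdeal (ResidueField O)) (ResidueField O) := isAdicComplete_field _
    set rk : absoluteGaloisGroup K →* GL (Fin 3) (ResidueField O) :=
      (Matrix.GeneralLinearGroup.map (algebraMap (ZMod 3) (ResidueField O))).comp (rbar f B) with hrk
    have hrk_abs : IsAbsIrreducible ((Matrix.GeneralLinearGroup.map (residue (ResidueField O))).comp rk) :=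
      IsAbsIrreducible.comp_map (IsAbsIrreducible.comp_map hirr _) _
    have htraces : ∀ g, (((Matrix.GeneralLinearGroup.map (residue O)).comp ρA) g).val.trace = (rk g).val.trace := by
      intro g
      rw [MonoidHom.comp_apply, trace_generalLinearGroup_map, hrk, MonoidHom.comp_apply, trace_generalLinearGroup_map,
        hres, hcast]
    obtain ⟨P₃, hP₃⟩ := hF3 (ResidueField O) (absoluteGaloisGroup K) 3 rk _ hrk_abs htraces
    rw [eq_conj_comp_of_forall hP₃]
    exact IsAbsIrreducible.conj (IsAbsIrreducible.comp_map hirr _) P₃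
  exact ⟨E₁, hfin₁, hle₀, ρA, P₁ * P₂', hconj, hcont, htr₀, hres, habs⟩

end IntegralModel

/-- **Summary (registered helper goal of `stub_point`)**: all traces of a continuous `ρ : Γ_K → GL₃(ℚ̄₃)`
with the Picard Frobenius traces off `S(f)` lie in `E₀ = ℚ₃(ι⁻¹ e ζ₃)`. -/
theorem pointDescent_trace_mem_E0 : ∀ {ι : PadicAlgCl 3 ≃+* ℂ} {e : K →+* ℂ} {f : ℤ[X]}, Generic f → ∀ (ρ : FramedGaloisRep K (PadicAlgCl 3) 3), (∀ 𝔭 ∉ badPrimes f, ρ.IsUnramifiedAt 𝔭 ∧ ∀ 𝔓 ∈ 𝔭.primesAbove, ∀ σ : absoluteGaloisGroup K, IsArithFrobAt (𝓞 K) σ 𝔓 → ρ.trace σ = picardC f ι e 𝔭) → ∀ g, ρ.trace g ∈ E₀ ι e :=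
  fun hgen ρ h1 g => trace_mem_E₀ hgen ρ h1 g

end

end Summit.Langlands.Langlands.Cruxes.MuOrdinaryFamilyRT.FreeSeedSmoothRt
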